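import Literature.NumberTheory.EllipticCurves.DivisionPolynomialFormalMulProofs
import Literature.NumberTheory.EllipticCurves.FormalGroupInfiniteHeightProofs
import Literature.NumberTheory.EllipticCurves.GoodReductionInertia
import HarnessLib

/-!
# Division polynomials at INFINITE HEIGHT: `[n] = 0 ⟹ ΨSqₙ = 0`; `p² ∣ ΨSq_p` for an integer model
# reducing to the cusp `y² = x³`; and then `|x(pP)| = |x(P)|/|p|²`, `pP ≠ O` on the kernel of reduction
# over EVERY valued field (cell `b2b-bsdres`, team n1011, seat p05 GEN 13, ROW T-O6-LOGA F2a = the TOOL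
# behind LEMMA A "additive ⇒ the `ℚ_p`-minimal formal group is `Ĝ_a`" AT POINTS; theorems only)

HONEST FRAMING (cell `b2b-bsdres`, run/shared/lean/b2b/bsd-rank1-residual/, verbatim in every file): the
goal of the cell is to DELETE the COMBINATION-SHAPED residual classes of the Birch–Swinnerton-Dyer formula
for ALL analytic-rank `≤ 1` elliptic curves over `ℚ` — "full BSD formula for every rank `≤ 1` curve in
class `C`" assembled STRICTLY from published theorems — so that the rank-`≤ 1` remainder becomes exactly
the CONSTRUCTION-SHAPED classes, which are TYPED (missing-input `Prop`s), NOT attempted. This is not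
"finishing BSD". Lane CLASS-CLOSURE / teams o5–o6 (O6 OPEN) and team n1011 (N10/N11): research routes;
census output is EVIDENCE, never a Literature fact; nothing is booked; no mark of `RESIDUAL-MAP.md`
moves. This file: THEOREMS ONLY (no definition, no named fact, no `@[conjecture]` node, no `sorry`; net
named-fact debt `0`); nothing about any particular curve is asserted.

## What is proved (class-free, model-level; consumed by `Additive/AdditiveKernelMultiplicationByP.lean`)

* §1 **`ΨSq_eq_zero_of_formalMul_eq_zero`**: for a Weierstrass equation `V` over ANY commutative ring and
  any `n`, `[n]_V = 0 ⟹ ΨSqₙ(V) = 0` — read off the tree's pole-free identity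
  `(Σᵢ ΨSqₙ[i] uⁱ z^{2(n²-1-i)}) · z² · u([n]z) = (Σᵢ Φₙ[i] uⁱ z^{2(n²-i)}) · [n](z)²`
  (`WeierstrassCurve.sum_ΨSq_mul_formalXMulSq_subst_formalMul`, `DivisionPolynomialFormalMulProofs`) by
  comparing orders at `z = 0` (the right side vanishes; on the left `u(0)` is a unit and the sum is
  `z^{2(n²-1-D)}(c + O(z))`, `c` the leading coefficient of `ΨSqₙ`); for odd `n` over a domain
  `preΨ'_eq_zero_of_formalMul_eq_zero` (`ΨSqₙ = ψ̃ₙ²`).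
* §2 **`sq_dvd_coeff_ΨSq_of_map_eq_zero`**: for an INTEGER model `V'` reducing mod `p` to `y² = x³` (all
  `aᵢ ≡ 0`), `p² ∣ ΨSq_p(V')[k]` for every `k` — odd `p`: the reduction has infinite height (`[p]˜ = 0`,
  tree `formalMul_eq_zero_of_a_eq_zero_of_charP`), so `ψ̃_p ≡ 0 (mod p)` coefficientwise by §1; `p = 2`:
  `ΨSq₂ = 4x³ + b₂x² + 2b₄x + b₆` with all `aᵢ` even.
* §3 over a VALUED FIELD `(F, |·|)` (`Valuation F ℝ≥0`, the chart currency of `FormalGroupChart`):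
  `val_intCast_eq_one_of_not_dvd` (an integer prime to `p` is a unit once `|p| < 1`, Bézout),
  `val_eval_eq_mul_pow` (dominant term with a scaled top coefficient), and
  **`val_x_zsmul_prime_of_val_coeff_le`**: if `p ≠ 0` in `F`, `|Φ_p[i]| ≤ 1` and `|ΨSq_p[i]| ≤ |p|²` for
  all `i`, then for every affine `P = (x, y)` with `|x| > 1`: `pP ≠ O` and `|x(pP)| · |p|² = |x|`
  (`x(pP)·ΨSq_p(x) = Φ_p(x)`, tree `mul_eval_ΨSq_of_zsmul_eq`; `|Φ_p(x)| = |x|^{p²}`,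
  `|ΨSq_p(x)| = |p|²|x|^{p²-1}`; `pP = O ⟹ ΨSq_p(x) = 0`, tree `zsmul_some_eq_zero_iff_eval_ΨSq`); the
  hypotheses hold for the base change of an integer model with `p² ∣ ΨSq_p`
  (`val_coeff_le_of_sq_dvd_coeff_ΨSq`).

This is the division-polynomial form of "the formal group of a cusp is `Ĝ_a`" (Silverman III.2.5: on
`y² = x³`, `ψₙ = n·x^{(n²-1)/2}`, `x(nP) = x/n²`), valid WITHOUT completeness and for every ramification —
the pattern of the tree's `Literature.NumberTheory.EllipticCurves.val_le_one_of_zsmul_eq_zero`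
(`GoodReductionInertia`: no `n`-torsion in `E₁` for `|n| = 1`) pushed to `n = p` at a cusp.

References: J. H. Silverman, *The Arithmetic of Elliptic Curves*, GTM 106 (2009), Prop. III.2.5, Exercise
3.7 (d), IV.1–IV.2, Prop. VII.2.2, VII.3.1 [SilvermanAEC2009]; T. Honda, J. Math. Soc. Japan 22 (1970) §2
(infinite height) [Honda1970].
-/

noncomputable section

open scoped Classical NNReal

open Polynomial WeierstrassCurve Literature.NumberTheory.EllipticCurves

namespace Summit.BirchSwinnertonDyer.Rank1Residual.Additive

/-! ## §1 Division polynomials at infinite height: `[n] = 0 ⟹ ΨSqₙ = 0` -/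

section InfiniteHeight

variable {S : Type*} [CommRing S] (V : WeierstrassCurve S)

/-- **At infinite height the `n`-division polynomial vanishes identically: `[n]_V = 0 ⟹ ΨSqₙ(V) = 0`**
(any commutative ring). Compare orders at `z = 0` in the tree's pole-free identity
`(Σᵢ ΨSqₙ[i] uⁱ z^{2(n²-1-i)}) · z² · u([n]z) = (Σᵢ Φₙ[i] uⁱ z^{2(n²-i)}) · [n](z)²` (`u = z²x(z)`,
`sum_ΨSq_mul_formalXMulSq_subst_formalMul`): the right side vanishes, and on the left `u([n]z) = u(0)`
is a unit and the sum is `z^{2(n²-1-D)}·(c + O(z))`, `D = deg ΨSqₙ`, `c` its leading coefficient.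
[cite: SilvermanAEC2009, Exercise 3.7(d)] -/
theorem ΨSq_eq_zero_of_formalMul_eq_zero (n : ℕ) (h0 : V.formalMul n = 0) : V.ΨSq n = 0 := by
  by_contra hΨ0
  have key := V.sum_ΨSq_mul_formalXMulSq_subst_formalMul n
  rw [h0, zero_pow two_ne_zero, mul_zero] at key
  -- `u(0)` is a unit
  have hu1 : PowerSeries.constantCoeff (V.formalXMulSq.subst (0 : PowerSeries S)) = 1 := by
    rw [constantCoeff_subst_eq_constantCoeff (map_zero _), constantCoeff_formalXMulSq]
  have hu : IsUnit (V.formalXMulSq.subst (0 : PowerSeries S)) := by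
    rw [PowerSeries.isUnit_iff_constantCoeff, hu1]; exact isUnit_one
  set D := (V.ΨSq n).natDegree with hD
  set c := (V.ΨSq n).leadingCoeff with hc
  have hc0 : c ≠ 0 := leadingCoeff_ne_zero.mpr hΨ0
  have hDle : D ≤ n ^ 2 - 1 := by
    have := V.natDegree_ΨSq_le n
    rwa [Int.natAbs_natCast] at this
  have hn1 : 1 ≤ n ^ 2 := by
    rcases Nat.eq_zero_or_pos n with rfl | hn
    · exact absurd (by rw [Nat.cast_zero, ΨSq_zero]) hΨ0
    · exact Nat.one_le_pow _ _ hn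
  -- the left sum is `X^{2(n²-1-D)} · B` with `B(0) = c`
  have hL : (∑ i ∈ Finset.range (n ^ 2),
      PowerSeries.C ((V.ΨSq n).coeff i) * V.formalXMulSq ^ i * PowerSeries.X ^ (2 * (n ^ 2 - 1 - i))) =
        PowerSeries.X ^ (2 * (n ^ 2 - 1 - D)) * ∑ i ∈ Finset.range (D + 1),
      PowerSeries.C ((V.ΨSq n).coeff i) * V.formalXMulSq ^ i * PowerSeries.X ^ (2 * (D - i)) := by
    rw [Finset.mul_sum, ← Finset.sum_subset (Finset.range_subset_range.mpr (by omega : D + 1 ≤ n ^ 2))]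
    · refine Finset.sum_congr rfl fun i hi => ?_
      rw [Finset.mem_range] at hi
      have e : 2 * (n ^ 2 - 1 - i) = 2 * (n ^ 2 - 1 - D) + 2 * (D - i) := by omega
      rw [e, pow_add]; ring
    · intro i _ hnot
      rw [Finset.mem_range, not_lt] at hnot
      rw [Polynomial.coeff_eq_zero_of_natDegree_lt (by omega), map_zero, zero_mul, zero_mul]
  have hB0 : PowerSeries.constantCoeff (∑ i ∈ Finset.range (D + 1),
      PowerSeries.C ((V.ΨSq n).coeff i) * V.formalXMulSq ^ i * PowerSeries.X ^ (2 * (D - i))) = c := by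
    rw [map_sum, Finset.sum_eq_single D]
    · rw [map_mul, map_mul, map_pow, map_pow, PowerSeries.constantCoeff_C, constantCoeff_formalXMulSq,
        one_pow, mul_one, Nat.sub_self, mul_zero, pow_zero, mul_one]
      rfl
    · intro i hi hne
      rw [Finset.mem_range] at hi
      have hpos : 2 * (D - i) ≠ 0 := by omega
      rw [map_mul, map_pow, PowerSeries.constantCoeff_X, zero_pow hpos, mul_zero]
    · intro hnot
      exact absurd (Finset.mem_range.mpr (Nat.lt_succ_self _)) hnot
  -- strip the unit `u(0)` and the powers of `X`, then read the constant coefficient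
  have key' := (hu.mul_left_eq_zero).mp key
  rw [hL] at key'
  have key'' : PowerSeries.X ^ (2 * (n ^ 2 - 1 - D) + 2) * (∑ i ∈ Finset.range (D + 1),
      PowerSeries.C ((V.ΨSq n).coeff i) * V.formalXMulSq ^ i * PowerSeries.X ^ (2 * (D - i))) = 0 := by
    rw [← key']; ring
  have := congrArg (PowerSeries.coeff (2 * (n ^ 2 - 1 - D) + 2)) key''
  rw [PowerSeries.coeff_X_pow_mul', if_pos le_rfl, Nat.sub_self, map_zero,
    PowerSeries.coeff_zero_eq_constantCoeff_apply, hB0] at this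
  exact hc0 this

/-- For ODD `n` over an integral domain, `[n]_V = 0 ⟹ ψ̃ₙ(V) = 0` (`ΨSqₙ = ψ̃ₙ²` for odd `n`).
[cite: SilvermanAEC2009, Exercise 3.7(d)] -/
theorem preΨ'_eq_zero_of_formalMul_eq_zero [IsDomain S] {n : ℕ} (hn : Odd n) (h0 : V.formalMul n = 0) :
    V.preΨ' n = 0 := by
  have h := ΨSq_eq_zero_of_formalMul_eq_zero V n h0
  rw [ΨSq_ofNat, if_neg (Nat.not_even_iff_odd.mpr hn), mul_one] at h
  exact pow_eq_zero_iff two_ne_zero |>.mp h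

end InfiniteHeight

/-! ## §2 An integer model reducing to `y² = x³`: `p² ∣ ΨSq_p` coefficientwise -/

section IntegerModel

variable (V' : WeierstrassCurve ℤ) (p : ℕ) [hp : Fact p.Prime]

/-- For an integer Weierstrass equation reducing mod `p` to the cusp `y² = x³` (all `aᵢ ≡ 0`), every
coefficient of the univariate `p`-division polynomial `ΨSq_p = ψ_p²` is divisible by `p²`: for odd `p`,
`ψ̃_p ≡ 0 (mod p)` coefficientwise since the reduction has infinite height (`[p]˜ = 0`,
`preΨ'_eq_zero_of_formalMul_eq_zero`); for `p = 2`, `ΨSq₂ = 4x³ + b₂x² + 2b₄x + b₆` with `aᵢ` even.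
[cite: SilvermanAEC2009, Exercise 3.7(d) and Prop. III.2.5] -/
theorem sq_dvd_coeff_ΨSq_of_map_eq_zero
    (h : V'.map (Int.castRingHom (ZMod p)) = ({ a₁ := 0, a₂ := 0, a₃ := 0, a₄ := 0, a₆ := 0 } :
      WeierstrassCurve (ZMod p))) (k : ℕ) :
    (p : ℤ) ^ 2 ∣ (V'.ΨSq p).coeff k := by
  have ha : ∀ a : ℤ, (Int.castRingHom (ZMod p)) a = 0 → (p : ℤ) ∣ a := fun a ha ↦
    (ZMod.intCast_zmod_eq_zero_iff_dvd a p).mp ha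
  have h₁ : (p : ℤ) ∣ V'.a₁ := ha _ (congrArg WeierstrassCurve.a₁ h)
  have h₂ : (p : ℤ) ∣ V'.a₂ := ha _ (congrArg WeierstrassCurve.a₂ h)
  have h₃ : (p : ℤ) ∣ V'.a₃ := ha _ (congrArg WeierstrassCurve.a₃ h)
  have h₄ : (p : ℤ) ∣ V'.a₄ := ha _ (congrArg WeierstrassCurve.a₄ h)
  have h₆ : (p : ℤ) ∣ V'.a₆ := ha _ (congrArg WeierstrassCurve.a₆ h)
  rcases hp.out.eq_two_or_odd' with rfl | hodd
  · -- `p = 2`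
    have hΨ : V'.ΨSq 2 = V'.Ψ₂Sq := V'.ΨSq_two
    have h4 : Polynomial.C ((2 : ℤ) ^ 2) ∣ V'.Ψ₂Sq := by
      have hb₂ : (2 : ℤ) ^ 2 ∣ V'.b₂ := by
        rw [WeierstrassCurve.b₂]
        obtain ⟨c, hc⟩ := h₁
        exact dvd_add (Dvd.intro (c ^ 2) (by rw [hc]; ring)) (Dvd.intro V'.a₂ (by ring))
      have hb₄ : (2 : ℤ) ^ 2 ∣ 2 * V'.b₄ := by
        rw [WeierstrassCurve.b₄]
        obtain ⟨c, hc⟩ := h₁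
        obtain ⟨d, hd⟩ := h₃
        exact Dvd.intro (V'.a₄ + 2 * c * d) (by rw [hc, hd]; ring)
      have hb₆ : (2 : ℤ) ^ 2 ∣ V'.b₆ := by
        rw [WeierstrassCurve.b₆]
        obtain ⟨d, hd⟩ := h₃
        exact dvd_add (Dvd.intro (d ^ 2) (by rw [hd]; ring)) (Dvd.intro V'.a₆ (by ring))
      rw [WeierstrassCurve.Ψ₂Sq]
      refine dvd_add (dvd_add (dvd_add ?_ ?_) ?_) ?_
      · exact Dvd.intro (X ^ 3) (by norm_num)
      · exact (map_dvd Polynomial.C hb₂).mul_right _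
      · exact (map_dvd Polynomial.C hb₄).mul_right _
      · exact map_dvd Polynomial.C hb₆
    rw [Nat.cast_ofNat, hΨ]
    exact (Polynomial.C_dvd_iff_dvd_coeff _ _).mp h4 k
  · -- odd `p`: `ψ̃_p ≡ 0 (mod p)`
    have hC0 : (V'.map (Int.castRingHom (ZMod p))).formalMul p = 0 := by
      rw [h]
      exact WeierstrassCurve.formalMul_eq_zero_of_a_eq_zero_of_charP _ p rfl rfl rfl rfl rfl
    have hpre : (V'.preΨ' p).map (Int.castRingHom (ZMod p)) = 0 := by
      rw [← WeierstrassCurve.map_preΨ']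
      exact preΨ'_eq_zero_of_formalMul_eq_zero _ hodd hC0
    have hdvd : Polynomial.C (p : ℤ) ∣ V'.preΨ' p := by
      refine (Polynomial.C_dvd_iff_dvd_coeff _ _).mpr fun i ↦ ha _ ?_
      have := congrArg (fun q ↦ q.coeff i) hpre
      simpa only [Polynomial.coeff_map, Polynomial.coeff_zero] using this
    obtain ⟨g, hg⟩ := hdvd
    have hΨ : V'.ΨSq p = Polynomial.C ((p : ℤ) ^ 2) * g ^ 2 := by
      rw [ΨSq_ofNat, if_neg (Nat.not_even_iff_odd.mpr hodd), mul_one, hg, mul_pow, ← map_pow]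
    rw [hΨ, Polynomial.coeff_C_mul]
    exact dvd_mul_right _ _

end IntegerModel

/-! ## §3 Over a valued field: `|x(pP)| = |x(P)|/|p|²` on the kernel of reduction -/

section Valued

variable {F : Type*} [Field F] (w : Valuation F ℝ≥0)

/-- An integer has valuation `≤ 1` (nonarchimedean triangle inequality on `1 + ⋯ + 1`). [folklore] -/
theorem val_intCast_le_one' (n : ℤ) : w (n : F) ≤ 1 := by
  have hnat : ∀ m : ℕ, w (m : F) ≤ 1 := fun m ↦ by
    induction m with
    | zero => simp
    | succ m ih =>
      rw [Nat.cast_succ]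
      exact (Valuation.map_add w _ _).trans (max_le ih (le_of_eq (map_one w)))
  obtain ⟨m, rfl | rfl⟩ := Int.eq_nat_or_neg n
  · rw [Int.cast_natCast]; exact hnat m
  · rw [Int.cast_neg, Int.cast_natCast, Valuation.map_neg]; exact hnat m

/-- **An integer prime to `p` is a `w`-unit when `|p| < 1`** (Bézout: `am + bp = 1`). [folklore] -/
theorem val_intCast_eq_one_of_not_dvd {p : ℕ} [hp : Fact p.Prime] (hp1 : w (p : F) < 1) {m : ℤ}
    (hm : ¬ (p : ℤ) ∣ m) : w (m : F) = 1 := by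
  refine le_antisymm (val_intCast_le_one' w m) ?_
  by_contra hlt
  rw [not_le] at hlt
  have hprime : Prime (p : ℤ) := Nat.prime_iff_prime_int.mp hp.out
  have hcop : IsCoprime m (p : ℤ) := ((Prime.coprime_iff_not_dvd hprime).mpr hm).symm
  obtain ⟨a, b, hab⟩ := hcop
  have h1 : w ((a * m + b * p : ℤ) : F) = 1 := by rw [hab, Int.cast_one, map_one]
  have hlt' : w ((a * m + b * p : ℤ) : F) < 1 := by
    push_cast
    refine Valuation.map_add_lt _ ?_ ?_
    · rw [map_mul]
      calc w (a : F) * w (m : F) ≤ 1 * w (m : F) := by gcongr; exact val_intCast_le_one' w a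
        _ < 1 := by rw [one_mul]; exact hlt
    · rw [map_mul]
      calc w (b : F) * w (p : F) ≤ 1 * w (p : F) := by gcongr; exact val_intCast_le_one' w b
        _ < 1 := by rw [one_mul]; exact hp1
  exact absurd h1 hlt'.ne

/-- Dominant term with a scaled top coefficient: if `q ∈ F[X]` has degree `≤ d`, `|q[d]| = c ≠ 0` and
`|q[i]| ≤ c` for all `i`, then `|q(x)| = c · |x|^d` for every `x` with `|x| > 1`. [folklore] -/
theorem val_eval_eq_mul_pow {q : F[X]} {d : ℕ} {c : ℝ≥0} (hc : c ≠ 0) (hq : ∀ i, w (q.coeff i) ≤ c)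
    (hd : q.natDegree ≤ d) (hlead : w (q.coeff d) = c) {x : F} (hx : 1 < w x) :
    w (q.eval x) = c * w x ^ d := by
  have htop : w (q.coeff d * x ^ d) = c * w x ^ d := by rw [map_mul, map_pow, hlead]
  rw [eval_eq_sum_range' (Nat.lt_succ_of_le hd), Finset.sum_range_succ,
    Valuation.map_add_eq_of_lt_right]
  · exact htop
  · rw [htop]
    refine Valuation.map_sum_lt _ (mul_ne_zero hc (pow_ne_zero _ (zero_lt_one.trans hx).ne')) fun i hi ↦ ?_
    rw [Finset.mem_range] at hi
    rw [map_mul, map_pow]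
    calc w (q.coeff i) * w x ^ i ≤ c * w x ^ i := by gcongr; exact hq i
      _ < c * w x ^ d := mul_lt_mul_of_pos_left (pow_lt_pow_right₀ hx hi) (pos_iff_ne_zero.mpr hc)

variable (V : WeierstrassCurve F) (p : ℕ) [hp : Fact p.Prime]

/-- **`|x(pP)| = |x(P)| / |p|²` and `pP ≠ O` on the kernel of reduction, for a Weierstrass equation over a
valued field `(F, |·|)` with `|Φ_p[i]| ≤ 1` and `|ΨSq_p[i]| ≤ |p|²` for all `i`** (and `p ≠ 0` in `F`). From
`x(pP)·ΨSq_p(x) = Φ_p(x)` (tree `mul_eval_ΨSq_of_zsmul_eq`): `|Φ_p(x)| = |x|^{p²}` (monic), `|ΨSq_p(x)| =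
|p|²|x|^{p²-1}` (top coefficient `p²`); and `pP = O` would force `ΨSq_p(x) = 0`
(`zsmul_some_eq_zero_iff_eval_ΨSq`). [cite: SilvermanAEC2009, Exercise 3.7(d)] -/
theorem val_x_zsmul_prime_of_val_coeff_le (hp0 : (p : F) ≠ 0) (hΦ : ∀ i, w ((V.Φ p).coeff i) ≤ 1)
    (hΨ : ∀ i, w ((V.ΨSq p).coeff i) ≤ w (p : F) ^ 2) {x y : F} (hxy : V.toAffine.Nonsingular x y)
    (hx : 1 < w x) :
    (p : ℤ) • (Affine.Point.some x y hxy) ≠ 0 ∧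
      ∀ {x' y' : F} (h' : V.toAffine.Nonsingular x' y'),
        (p : ℤ) • (Affine.Point.some x y hxy) = Affine.Point.some x' y' h' → w x' * w (p : F) ^ 2 = w x := by
  have hpw : w (p : F) ≠ 0 := (Valuation.ne_zero_iff w).mpr hp0
  have hc : w (p : F) ^ 2 ≠ 0 := pow_ne_zero 2 hpw
  have hx0 : w x ≠ 0 := (zero_lt_one.trans hx).ne'
  -- `|ΨSq_p(x)| = |p|² |x|^{p² - 1}`
  have hΨv : w ((V.ΨSq p).eval x) = w (p : F) ^ 2 * w x ^ (p ^ 2 - 1) := by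
    refine val_eval_eq_mul_pow w hc hΨ ?_ ?_ hx
    · have := V.natDegree_ΨSq_le p
      rwa [Int.natAbs_natCast] at this
    · have := V.coeff_ΨSq p
      rw [Int.natAbs_natCast] at this
      rw [this, Int.cast_natCast, map_pow]
  -- `|Φ_p(x)| = |x|^{p²}`
  have hΦv : w ((V.Φ p).eval x) = w x ^ (p ^ 2) := by
    refine Literature.NumberTheory.EllipticCurves.val_eval_eq_pow hΦ ?_ ?_ hx
    · have := V.natDegree_Φ_le p
      rwa [Int.natAbs_natCast] at this
    · have := V.coeff_Φ p
      rw [Int.natAbs_natCast] at this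
      rw [this, map_one]
  refine ⟨fun h0 ↦ ?_, fun {x' y'} h' he ↦ ?_⟩
  · have hz : (V.ΨSq p).eval x = 0 := (V.zsmul_some_eq_zero_iff_eval_ΨSq hxy p).mp h0
    rw [hz, map_zero] at hΨv
    exact mul_ne_zero hc (pow_ne_zero _ hx0) hΨv.symm
  · have hmul := V.mul_eval_ΨSq_of_zsmul_eq hxy p h' he
    have hv := congrArg w hmul
    rw [map_mul, hΨv, hΦv] at hv
    have e : w x ^ (p ^ 2) = w x * w x ^ (p ^ 2 - 1) := by
      rw [← pow_succ', Nat.sub_add_cancel (Nat.one_le_pow _ _ hp.out.pos)]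
    rw [e, ← mul_assoc] at hv
    exact mul_right_cancel₀ (pow_ne_zero _ hx0) hv

omit hp in
/-- The hypotheses of `val_x_zsmul_prime_of_val_coeff_le` for the base change of an INTEGER model with
`p² ∣ ΨSq_p` coefficientwise. [folklore] -/
theorem val_coeff_le_of_sq_dvd_coeff_ΨSq (V' : WeierstrassCurve ℤ) (hΨ : ∀ k, (p : ℤ) ^ 2 ∣ (V'.ΨSq p).coeff k) :
    (∀ i, w (((V'.map (Int.castRingHom F)).Φ p).coeff i) ≤ 1) ∧
      ∀ i, w (((V'.map (Int.castRingHom F)).ΨSq p).coeff i) ≤ w (p : F) ^ 2 := by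
  refine ⟨fun i ↦ ?_, fun i ↦ ?_⟩
  · rw [map_Φ, coeff_map, eq_intCast]; exact val_intCast_le_one' w _
  · rw [map_ΨSq, coeff_map, eq_intCast]
    obtain ⟨m, hm⟩ := hΨ i
    rw [hm, Int.cast_mul, Int.cast_pow, Int.cast_natCast, map_mul, map_pow]
    calc w (p : F) ^ 2 * w (m : F) ≤ w (p : F) ^ 2 * 1 := by gcongr; exact val_intCast_le_one' w m
      _ = w (p : F) ^ 2 := mul_one _

end Valued

end Summit.BirchSwinnertonDyer.Rank1Residual.Additive
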